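import Summits.SmoothPoincare4.SmoothPoincare4.Theorems.SblfDescentRungOneStubBaseFunctionLagrange
import Literature.Topology.FourManifolds.SimplifiedBrokenLefschetzSidesGenus
import Literature.Topology.FourManifolds.SimplifiedBrokenLefschetzRoundSlicesIndex
import Literature.Topology.FourManifolds.SimplifiedBrokenLefschetzHeight
import Literature.Topology.FourManifolds.SphereHeightFoldCurves
import HarnessLib

/-!
# The base function `y₀ (1 - ⟪y, v⟫/4)` on the round 2-sphere, II — stub `stub_baseFunction`
# of line `Sketch`, crux `SblfDescent.RungOne`

(Crux item stmt-SmoothPoincare4-18531; skeleton `Cruxes/RungOne/Lines/Sketch.lean`.)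

The line `Sketch` reads a genus-one simplified broken Lefschetz fibration `f : X → S²` with
round image the equator through the Morse function `ℓ ∘ f`, `ℓ(y) = y₀ (1 + κ ⟪y, v⟫)`,
`κ = -1/4`, `v = (0, 0, ±1)` a pole (Baykur 2012, Lemma 7, made quantitative).  This file
proves the stub `stub_baseFunction`: **`ℓ` is a Morse function on the round sphere with exactly
two critical points**, the minimum `m = (-r, 0, s v₂)` (index `0`) and the maximum
`M = (r, 0, s v₂)` (index `2`), where `s = 1 - √(3/2) ≈ -0.2247` is the root of
`s² - 2s - 1/2` in `[-1, 1]` and `r = √(1 - s²)`; both lie in the open hemisphere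
`{⟪·, v⟫ < 0}` off the meridian `{y₁ = 0}`-complement, and `ℓ(M) = -ℓ(m) = r (1 - s/4) > 1`.

Proof: Part I (`SblfDescentRungOneStubBaseFunctionLagrange.lean`, helper `helper_basePoint`)
supplies Lagrange's condition in coordinates and the two critical points with definite
Hessians; here `base_classify` solves Lagrange's equations (`ν ≠ 0`, `y₁ = 0`,
`⟪y, v⟫ ∈ {s, 2 - s}`), the extrema of `ℓ` on the compact sphere are critical hence are `m`
and `M`, and the indices of a minimum / a nondegenerate maximum are `0` / `dim = 2`
(`IsLocalMin.morseIndex_eq_zero`, `IsMorse.morseIndex_eq_finrank_of_isLocalMax`;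
Milnor 1963, §2).  Everything is proved; no definitions, no named facts.

## References

* J. Milnor, *Morse theory*, Ann. of Math. Studies 51 (1963), §2. [Milnor1963]
* R. İ. Baykur, *Broken Lefschetz fibrations and smooth structures on 4-manifolds*, Geom.
  Topol. Monogr. 18 (2012), Lemma 7. [Baykur2012]
-/

-- the prescribed namespace `Summit.<P>.<Sub>.…` duplicates `SmoothPoincare4` (P = Sub)
set_option linter.dupNamespace false

noncomputable section

open scoped Manifold ContDiff Topology RealInnerProductSpace
open Set Function Literature.Topology.FourManifolds Literature.AlgebraicTopology.SingularHomology

namespace Summit.SmoothPoincare4.SmoothPoincare4.Cruxes.RungOne.Sketch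

/-- Local notation: `𝔼 n` is the model Euclidean space `EuclideanSpace ℝ (Fin n)`. -/
local notation "𝔼 " n:arg => EuclideanSpace ℝ (Fin n)

/-- Local notation: `𝕊²`, the unit sphere of `ℝ³`. -/
local notation "𝕊²" => (Metric.sphere (0 : EuclideanSpace ℝ (Fin 3)) (1 : ℝ))

attribute [local instance] Literature.Topology.FourManifolds.fact_finrank_euclideanSpace_succ

/-- **Classification of the critical points of the base function**: a critical point `y` of `ℓ` has `y₁ = 0`, `y₂ = s v₂` and `y₀ = ± r` (Lagrange:
the multiplier `ν = 0` would force `⟪y, v⟫ = 4`; so `y₁ = 0`, and `S = ⟪y, v⟫` solves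
`S² - 2S - 1/2 = 0` with `|S| ≤ 1`, i.e. `S = s`, the other root `2 - s` being `> 1`).
[cite: Milnor1963, §2] -/
theorem base_classify : ∀ (v : 𝕊²), (v : 𝔼 3) 0 = 0 → (v : 𝔼 3) 1 = 0 →
    ∀ ℓ : 𝕊² → ℝ, ℓ = (fun y : 𝕊² => (y : 𝔼 3) 0 * (1 + (-(1 / 4 : ℝ)) * ⟪(y : 𝔼 3), (v : 𝔼 3)⟫)) →
    ∀ s r : ℝ, s ^ 2 - 2 * s - 1 / 2 = 0 → s < 0 → r ^ 2 = 1 - s ^ 2 →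
    ∀ y : 𝕊², IsMCriticalPt (𝓡 2) ℓ y →
    (y : 𝔼 3) 1 = 0 ∧ (y : 𝔼 3) 2 = s * (v : 𝔼 3) 2 ∧ ((y : 𝔼 3) 0 = r ∨ (y : 𝔼 3) 0 = -r) := by
  intro v hv0 hv1 ℓ hℓ s r hs hs0 hr y hc
  obtain ⟨ν, h0, h1, h2⟩ := (isMCriticalPt_base_iff v hv0 hv1 ℓ hℓ y).1 hc
  have hV := pole_sq v hv0 hv1
  have hN := (mem_sphere_iff_coord (y : 𝔼 3)).1 y.2
  set y0 : ℝ := (y : 𝔼 3) 0 with hy0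
  set y1 : ℝ := (y : 𝔼 3) 1 with hy1
  set y2 : ℝ := (y : 𝔼 3) 2 with hy2
  set v2 : ℝ := (v : 𝔼 3) 2 with hv2
  have hS1 : (y2 * v2) ^ 2 ≤ 1 := by
    nlinarith [hN, hV, sq_nonneg y0, sq_nonneg y1, sq_nonneg y2]
  have hν : ν ≠ 0 := by
    rintro rfl
    rw [zero_mul] at h0
    nlinarith [h0, hS1]
  have hy1z : y1 = 0 := by
    rcases mul_eq_zero.1 h1.symm with h | h
    · exact absurd h hν
    · exact h
  have e1 : ν * (y2 * v2) = (-(1 / 4 : ℝ)) * y0 := by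
    linear_combination (-v2) * h2 - (1 / 4) * y0 * hV
  have e2 : (1 + (-(1 / 4 : ℝ)) * (y2 * v2)) * (y2 * v2) = (-(1 / 4 : ℝ)) * y0 ^ 2 := by
    linear_combination (y2 * v2) * h0 + y0 * e1
  have e3 : y0 ^ 2 = 1 - (y2 * v2) ^ 2 := by
    rw [hy1z] at hN
    linear_combination hN + y2 ^ 2 * hV
  have hSq : (y2 * v2) ^ 2 - 2 * (y2 * v2) - 1 / 2 = 0 := by
    linear_combination (-2) * e2 + (1 / 2) * e3
  have hroots : (y2 * v2 - s) * (y2 * v2 - (2 - s)) = 0 := by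
    linear_combination hSq - hs
  have hS : y2 * v2 = s := by
    rcases mul_eq_zero.1 hroots with h | h
    · linarith
    · exfalso
      have hgt : 1 < y2 * v2 := by linarith
      nlinarith [hS1, hgt]
  refine ⟨hy1z, ?_, ?_⟩
  · linear_combination v2 * hS - y2 * hV
  · have h02 : y0 ^ 2 = r ^ 2 := by rw [e3, hS, hr]
    have hprod : (y0 - r) * (y0 + r) = 0 := by linear_combination h02
    rcases mul_eq_zero.1 hprod with h | h
    · left; linarith
    · right; linarith

/-- **Stub `stub_baseFunction` of line `Sketch` (crux `SblfDescent.RungOne`): the base function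
`ℓ(y) = y₀ (1 - ⟪y, v⟫/4)` on the round sphere is a Morse function with exactly two critical
points.**  For a pole `v = (0, 0, ±1)`: `ℓ` is smooth; its critical points are
`m = (-r, 0, s v₂)` and `M = (r, 0, s v₂)` with `s = 1 - √(3/2)` (the root of `s² - 2s - 1/2`
in `[-1, 1]`) and `r = √(1 - s²)` (Lagrange multipliers, `helper_basePoint`, `base_classify`);
both are nondegenerate (the Hessian is definite there), `m` is the minimum (index `0`) and `M`
the maximum (index `2` — a nondegenerate maximum of a Morse function on a surface), with
`⟪m, v⟫ = ⟪M, v⟫ = s < 0`, `m₁ = M₁ = 0`, `m₀ = -r < 0 < r = M₀`, and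
`ℓ(M) = -ℓ(m) = r (1 - s/4) > 1` (Milnor 1963, §2; this is the base factor of the Morse
function `ℓ ∘ f` of Baykur 2012, Lemma 7, made explicit). [cite: Milnor1963, §2] -/
theorem stub_baseFunction :
    ∀ (v : 𝕊²), (v : 𝔼 3) 0 = 0 → (v : 𝔼 3) 1 = 0 →
      ∀ ℓ : 𝕊² → ℝ, ℓ = (fun y : 𝕊² => (y : 𝔼 3) 0 * (1 + (-(1 / 4 : ℝ)) * ⟪(y : 𝔼 3), (v : 𝔼 3)⟫)) →
      ContMDiff (𝓡 2) 𝓘(ℝ, ℝ) ∞ ℓ ∧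
      ∃ m M : 𝕊², m ≠ M ∧
        (∀ y : 𝕊², IsMCriticalPt (𝓡 2) ℓ y ↔ (y = m ∨ y = M)) ∧
        (mhessian (𝓡 2) ℓ m).Nondegenerate ∧ (mhessian (𝓡 2) ℓ M).Nondegenerate ∧
        morseIndex (𝓡 2) ℓ m = 0 ∧ morseIndex (𝓡 2) ℓ M = 2 ∧
        ⟪(m : 𝔼 3), (v : 𝔼 3)⟫ < 0 ∧ ⟪(M : 𝔼 3), (v : 𝔼 3)⟫ < 0 ∧
        (m : 𝔼 3) 1 = 0 ∧ (M : 𝔼 3) 1 = 0 ∧ (m : 𝔼 3) 0 < 0 ∧ 0 < (M : 𝔼 3) 0 ∧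
        ℓ m < -1 ∧ 1 < ℓ M ∧ ∀ y : 𝕊², ℓ m ≤ ℓ y ∧ ℓ y ≤ ℓ M := by
  intro v hv0 hv1 ℓ hℓ
  have hV : (v : 𝔼 3) 2 ^ 2 = 1 := pole_sq v hv0 hv1
  -- the constants `t = √(3/2)`, `s = 1 - t`, `r = √(1 - s²)`
  obtain ⟨t, ht2, htlo, hthi⟩ : ∃ t : ℝ, t ^ 2 = 3 / 2 ∧ 122 / 100 < t ∧ t < 123 / 100 :=
    ⟨Real.sqrt (3 / 2), Real.sq_sqrt (by norm_num), (Real.lt_sqrt (by norm_num)).2 (by norm_num),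
      (Real.sqrt_lt' (by norm_num)).2 (by norm_num)⟩
  set s : ℝ := 1 - t with hs
  have hQ : s ^ 2 - 2 * s - 1 / 2 = 0 := by rw [hs]; linear_combination ht2
  have hs0 : s < 0 := by rw [hs]; linarith
  have hs1 : -(1 / 4 : ℝ) < s := by rw [hs]; linarith
  obtain ⟨r, hr2, hr0⟩ : ∃ r : ℝ, r ^ 2 = 1 - s ^ 2 ∧ 0 < r :=
    ⟨Real.sqrt (1 - s ^ 2), Real.sq_sqrt (by nlinarith), Real.sqrt_pos.2 (by nlinarith)⟩
  -- the two critical points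
  have hmem : ∀ ε : ℝ, ε ^ 2 = 1 →
      (WithLp.toLp 2 ![ε * r, 0, s * (v : 𝔼 3) 2] : 𝔼 3) ∈ 𝕊² := by
    intro ε hε
    rw [mem_sphere_iff_coord]
    simp
    linear_combination r ^ 2 * hε + s ^ 2 * hV + hr2
  set M : 𝕊² := ⟨WithLp.toLp 2 ![1 * r, 0, s * (v : 𝔼 3) 2], hmem 1 (by norm_num)⟩ with hM
  set m : 𝕊² := ⟨WithLp.toLp 2 ![(-1) * r, 0, s * (v : 𝔼 3) 2], hmem (-1) (by norm_num)⟩ with hm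
  have hM0 : (M : 𝔼 3) 0 = 1 * r := by simp [hM]
  have hM1 : (M : 𝔼 3) 1 = 0 := by simp [hM]
  have hM2 : (M : 𝔼 3) 2 = s * (v : 𝔼 3) 2 := by simp [hM]
  have hm0 : (m : 𝔼 3) 0 = (-1) * r := by simp [hm]
  have hm1 : (m : 𝔼 3) 1 = 0 := by simp [hm]
  have hm2 : (m : 𝔼 3) 2 = s * (v : 𝔼 3) 2 := by simp [hm]
  obtain ⟨hcM, hHM, hℓM⟩ :=
    helper_basePoint v hv0 hv1 ℓ hℓ s r 1 hQ hs0 hr2 hr0 (by norm_num) M hM0 hM1 hM2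
  obtain ⟨hcm, hHm, hℓm⟩ :=
    helper_basePoint v hv0 hv1 ℓ hℓ s r (-1) hQ hs0 hr2 hr0 (by norm_num) m hm0 hm1 hm2
  -- the critical value `r (1 - s / 4) > 1`
  have hval : 1 < r * (1 + (-(1 / 4 : ℝ)) * s) := by
    have hr2' : r ^ 2 = 2 * t - t ^ 2 := by rw [hr2, hs]; ring
    have hx2 : (r * (1 + (-(1 / 4 : ℝ)) * s)) ^ 2 = 3 * t / 4 + 9 / 64 := by
      rw [hs]
      linear_combination ((3 + t) / 4) ^ 2 * hr2' + ((-t ^ 2 - 4 * t + 3 / 2) / 16) * ht2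
    have hxpos : 0 ≤ r * (1 + (-(1 / 4 : ℝ)) * s) := mul_nonneg hr0.le (by linarith)
    rw [← one_lt_sq_iff₀ hxpos, hx2]
    linarith
  -- classification of the critical points
  have hclass : ∀ y : 𝕊², IsMCriticalPt (𝓡 2) ℓ y → y = m ∨ y = M := by
    intro y hy
    obtain ⟨h1, h2, h0 | h0⟩ := base_classify v hv0 hv1 ℓ hℓ s r hQ hs0 hr2 y hy
    · right
      refine Subtype.ext ?_
      ext i
      fin_cases i
      · simpa [hM] using h0
      · simpa [hM] using h1
      · simpa [hM] using h2
    · left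
      refine Subtype.ext ?_
      ext i
      fin_cases i
      · simpa [hm] using h0
      · simpa [hm] using h1
      · simpa [hm] using h2
  have hcrit : ∀ y : 𝕊², IsMCriticalPt (𝓡 2) ℓ y ↔ (y = m ∨ y = M) := fun y =>
    ⟨hclass y, fun h => h.elim (fun h => h ▸ hcm) (fun h => h ▸ hcM)⟩
  -- smoothness, nondegeneracy, Morse
  have hsmooth : ContMDiff (𝓡 2) 𝓘(ℝ, ℝ) ∞ ℓ := by
    rw [hℓ]
    exact (contDiff_basePoly (-(1 / 4 : ℝ)) (v : 𝔼 3)).comp_contMDiff contMDiff_coe_sphere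
  have hnd_of : ∀ (y : 𝕊²) (ε : ℝ), (∀ a : 𝔼 2, a ≠ 0 → ε * mhessian (𝓡 2) ℓ y a a < 0) →
      (mhessian (𝓡 2) ℓ y).Nondegenerate := by
    intro y ε h
    have key : ∀ a : 𝔼 2, mhessian (𝓡 2) ℓ y a a = 0 → a = 0 := fun a ha => by
      by_contra h0
      have := h a h0
      rw [ha, mul_zero] at this
      exact lt_irrefl _ this
    exact ⟨fun a ha => key a (ha a), fun a ha => key a (ha a)⟩
  have hndM := hnd_of M 1 hHM
  have hndm := hnd_of m (-1) hHm
  have hMorse : IsMorse (𝓡 2) ℓ :=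
    ⟨hsmooth, fun y hy => (hclass y hy).elim (fun h => h ▸ hndm) (fun h => h ▸ hndM)⟩
  -- values at the critical points
  have hvm : ℓ m < -1 := by rw [hℓm]; linarith
  have hvM : 1 < ℓ M := by rw [hℓM]; linarith
  -- global extrema (compactness of the sphere) are critical, hence `m` and `M`
  obtain ⟨p, -, hp⟩ :=
    isCompact_univ.exists_isMaxOn univ_nonempty hsmooth.continuous.continuousOn
  obtain ⟨q, -, hq⟩ :=
    isCompact_univ.exists_isMinOn univ_nonempty hsmooth.continuous.continuousOn
  have hpmax : IsLocalMax ℓ p := hp.isLocalMax Filter.univ_mem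
  have hqmin : IsLocalMin ℓ q := hq.isLocalMin Filter.univ_mem
  have hp' : ∀ y, ℓ y ≤ ℓ p := fun y => isMaxOn_iff.1 hp y (mem_univ y)
  have hq' : ∀ y, ℓ q ≤ ℓ y := fun y => isMinOn_iff.1 hq y (mem_univ y)
  have hpM : p = M := by
    rcases hclass p (IsLocalMax.isMCriticalPt hpmax) with h | h
    · have := hp' M
      rw [h] at this
      linarith
    · exact h
  have hqm : q = m := by
    rcases hclass q (IsLocalMin.isMCriticalPt hqmin) with h | h
    · exact h
    · have := hq' m
      rw [h] at this
      linarith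
  -- indices: a minimum has index `0`, a maximum of a Morse function index `dim = 2`
  have hidxm : morseIndex (𝓡 2) ℓ m = 0 := by
    rw [← hqm]
    exact IsLocalMin.morseIndex_eq_zero ((hsmooth q).of_le (by norm_cast)) hqmin
  have hidxM : morseIndex (𝓡 2) ℓ M = 2 := by
    rw [← hpM, hMorse.morseIndex_eq_finrank_of_isLocalMax hpmax, finrank_euclideanSpace_fin]
  -- assembly
  refine ⟨hsmooth, m, M, ?_, hcrit, hndm, hndM, hidxm, hidxM, ?_, ?_, hm1, hM1, ?_, ?_, hvm, hvM,
    fun y => ⟨?_, ?_⟩⟩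
  · intro h
    have := congrArg (fun z : 𝕊² => (z : 𝔼 3) 0) h
    rw [hm0, hM0] at this
    linarith
  · rw [inner_pole v hv0 hv1, hm2]
    have : s * (v : 𝔼 3) 2 * (v : 𝔼 3) 2 = s := by linear_combination s * hV
    linarith
  · rw [inner_pole v hv0 hv1, hM2]
    have : s * (v : 𝔼 3) 2 * (v : 𝔼 3) 2 = s := by linear_combination s * hV
    linarith
  · rw [hm0]; linarith
  · rw [hM0]; linarith
  · rw [← hqm]; exact hq' y
  · rw [← hpM]; exact hp' y

end Summit.SmoothPoincare4.SmoothPoincare4.Cruxes.RungOne.Sketch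

end
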